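import Literature.AlgebraicGeometry.Resolution.MvPolynomialKillVars
import Mathlib.RingTheory.RegularLocalRing.Polynomial
import HarnessLib

/-!
# Crux `PatchingRelPerfect` (stmt-ResolutionOfSingularities-16161), chain w52 — rung toolkit:
# the quotient of a polynomial ring by a GRAPH `X_v + q` (`q` not involving `X_v`)

[OURS · L1 W5.2 · rung tool] The exceptional curves of the two-planes member (design note
NEXT-two-planes-cube.md, Addendum 6, pieces P1–P3) are cut out of polynomial rings by equations of
the form `X_v + q = 0` with `q` free of the variable `X_v` (`ē₁ + X ē₂³`, `S + ē₂³`, `1 + X z̄`, …).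
The shear `X_v ↦ X_v − q` is an algebra automorphism carrying `X_v + q` to `X_v`, so the quotient is
the polynomial ring in the remaining variables (`Literature…MvPolynomialKillVars`):

* `aeval_shear_of_notMem_vars`, `shear_comp_shear`, `exists_shearEquiv` (the shear and its inverse;
  stated as existence, no new definitions);
* `exists_quotSpanXAddEquiv` — `κ[T_τ] ⧸ (X_v + q) ≅ κ[T_w : w ≠ v]`, `[X_w] ↦ X_w`;
* `isDomain_quot_span_X_add`, `isRegularRing_quot_span_X_add`, `X_notMem_span_X_add`.

Arbitrary commutative rings; nothing here is a statement of the manuscript under review.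

## References

* The Stacks Project, Tag 00S9 (polynomial algebras). [StacksProject]
-/

-- `Summit.<Summit>.<Sub>.Theorems` with `Sub = Summit` (single-conjunct summit, D-0017)
set_option linter.dupNamespace false

noncomputable section

open Literature.AlgebraicGeometry.Resolution

namespace Summit.ResolutionOfSingularities.ResolutionOfSingularities.Theorems

namespace PolyShear

universe u v

variable {κ : Type u} [CommRing κ] {τ : Type v} [DecidableEq τ] (v : τ)

/-- A polynomial not involving `X_v` is fixed by the shear substitution `X_v ↦ X_v + r`
(other variables fixed). [folklore] -/
theorem aeval_shear_of_notMem_vars (r : MvPolynomial τ κ) {p : MvPolynomial τ κ} (hp : v ∉ p.vars) :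
    MvPolynomial.aeval (fun w => if w = v then MvPolynomial.X v + r else MvPolynomial.X w) p = p := by
  change (MvPolynomial.aeval (R := κ)
      (fun w => if w = v then MvPolynomial.X v + r else MvPolynomial.X w)).toRingHom p =
    (RingHom.id _) p
  refine MvPolynomial.hom_congr_vars ?_ (fun w hw _ => ?_) rfl
  · ext a
    simp
  · have hwv : w ≠ v := fun h => hp (h ▸ hw)
    change MvPolynomial.aeval (R := κ)
        (fun w => if w = v then MvPolynomial.X v + r else MvPolynomial.X w) (MvPolynomial.X w) =
      MvPolynomial.X w
    simp [hwv]

/-- The shears by `r` and `-r` compose to the identity when `r` does not involve `X_v`. [folklore] -/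
theorem shear_comp_shear {r : MvPolynomial τ κ} (hr : v ∉ r.vars) :
    (MvPolynomial.aeval (R := κ)
        (fun w => if w = v then MvPolynomial.X v + -r else MvPolynomial.X w)).comp
      (MvPolynomial.aeval (fun w => if w = v then MvPolynomial.X v + r else MvPolynomial.X w)) =
      AlgHom.id κ (MvPolynomial τ κ) := by
  refine MvPolynomial.algHom_ext fun w => ?_
  rw [AlgHom.comp_apply, AlgHom.id_apply, MvPolynomial.aeval_X]
  by_cases hw : w = v
  · subst hw
    rw [if_pos rfl, map_add, MvPolynomial.aeval_X, if_pos rfl, aeval_shear_of_notMem_vars w (-r) hr]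
    ring
  · rw [if_neg hw, MvPolynomial.aeval_X, if_neg hw]

/-- **The shear automorphism** `X_v ↦ X_v − q` carries `X_v + q` to `X_v` and fixes the other
variables (`q` not involving `X_v`). [folklore] -/
theorem exists_shearEquiv {q : MvPolynomial τ κ} (hq : v ∉ q.vars) :
    ∃ e : MvPolynomial τ κ ≃ₐ[κ] MvPolynomial τ κ,
      e (MvPolynomial.X v + q) = MvPolynomial.X v ∧
        ∀ w, w ≠ v → e (MvPolynomial.X w) = MvPolynomial.X w := by
  have hq' : v ∉ (-q).vars := by rwa [MvPolynomial.vars_neg]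
  have h1 := shear_comp_shear v (r := q) hq
  have h2 := shear_comp_shear v (r := -q) hq'
  rw [neg_neg] at h2
  refine ⟨AlgEquiv.ofAlgHom _ _ h1 h2, ?_, fun w hw => ?_⟩
  · change MvPolynomial.aeval (R := κ)
        (fun w => if w = v then MvPolynomial.X v + -q else MvPolynomial.X w) (MvPolynomial.X v + q) =
      MvPolynomial.X v
    rw [map_add, MvPolynomial.aeval_X, if_pos rfl, aeval_shear_of_notMem_vars v (-q) hq]
    ring
  · change MvPolynomial.aeval (R := κ)
        (fun w => if w = v then MvPolynomial.X v + -q else MvPolynomial.X w) (MvPolynomial.X w) =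
      MvPolynomial.X w
    rw [MvPolynomial.aeval_X, if_neg hw]

/-- **`κ[T_τ] ⧸ (X_v + q) ≅ κ[T_w : w ≠ v]`** for `q` not involving `X_v`, by an isomorphism taking
the class of `X_w` (`w ≠ v`) to `X_w`. [cite: StacksProject, Tag 00S9] -/
theorem exists_quotSpanXAddEquiv {q : MvPolynomial τ κ} (hq : v ∉ q.vars) :
    ∃ E : (MvPolynomial τ κ ⧸ Ideal.span {MvPolynomial.X v + q}) ≃+*
        MvPolynomial {w : τ // w ∉ ({v} : Set τ)} κ,
      ∀ (w : τ) (hw : w ≠ v), E (Ideal.Quotient.mk _ (MvPolynomial.X w)) =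
        MvPolynomial.X ⟨w, fun h => hw (Set.mem_singleton_iff.mp h)⟩ := by
  obtain ⟨e, he, hew⟩ := exists_shearEquiv v hq
  have hmap : Ideal.span (MvPolynomial.X '' ({v} : Set τ) : Set (MvPolynomial τ κ)) =
      (Ideal.span {MvPolynomial.X v + q}).map (e.toRingEquiv : _ →+* _) := by
    rw [Ideal.map_span, Set.image_singleton, Set.image_singleton]
    exact congrArg (fun t => Ideal.span {t}) he.symm
  refine ⟨(Ideal.quotientEquiv _ _ e.toRingEquiv hmap).trans
    (MvPolynomial.quotientSpanXEquiv ({v} : Set τ)).toRingEquiv, fun w hw => ?_⟩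
  rw [RingEquiv.trans_apply, Ideal.quotientEquiv_apply, RingHom.toFun_eq_coe, Ideal.quotientMap_mk]
  change MvPolynomial.quotientSpanXEquiv ({v} : Set τ)
      (Ideal.Quotient.mk _ (e.toRingEquiv (MvPolynomial.X w))) = _
  rw [show e.toRingEquiv (MvPolynomial.X w) = MvPolynomial.X w from hew w hw]
  exact MvPolynomial.quotientSpanXEquiv_mk_X ({v} : Set τ) (fun h => hw (Set.mem_singleton_iff.mp h))

/-- The quotient by a graph is a domain over a domain. [cite: StacksProject, Tag 00S9] -/
theorem isDomain_quot_span_X_add [IsDomain κ] {q : MvPolynomial τ κ} (hq : v ∉ q.vars) :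
    IsDomain (MvPolynomial τ κ ⧸ Ideal.span {MvPolynomial.X v + q}) := by
  obtain ⟨E, -⟩ := exists_quotSpanXAddEquiv v hq
  exact E.toMulEquiv.isDomain _

/-- The quotient by a graph is a regular ring over a regular ring (finitely many variables).
[cite: StacksProject, Tag 00S9] -/
theorem isRegularRing_quot_span_X_add [IsRegularRing κ] [Finite τ] {q : MvPolynomial τ κ}
    (hq : v ∉ q.vars) : IsRegularRing (MvPolynomial τ κ ⧸ Ideal.span {MvPolynomial.X v + q}) := by
  obtain ⟨E, -⟩ := exists_quotSpanXAddEquiv v hq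
  exact IsRegularRing.of_ringEquiv (R := MvPolynomial {w : τ // w ∉ ({v} : Set τ)} κ) E.symm

/-- A variable other than `X_v` does not vanish on the graph. [folklore] -/
theorem X_notMem_span_X_add [Nontrivial κ] {q : MvPolynomial τ κ} (hq : v ∉ q.vars) {w : τ}
    (hw : w ≠ v) : (MvPolynomial.X w : MvPolynomial τ κ) ∉ Ideal.span {MvPolynomial.X v + q} := by
  intro h
  obtain ⟨E, hE⟩ := exists_quotSpanXAddEquiv v hq
  have h0 : E (Ideal.Quotient.mk _ (MvPolynomial.X w)) = 0 := by
    rw [Ideal.Quotient.eq_zero_iff_mem.mpr h, map_zero]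
  rw [hE w hw] at h0
  exact MvPolynomial.X_ne_zero _ h0

end PolyShear

end Summit.ResolutionOfSingularities.ResolutionOfSingularities.Theorems

end
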